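import Mathlib
import Literature.Analysis.Convex.SchauderFixedPoint
import HarnessLib

/-!
# Nash's theorem: every finite game has an equilibrium point in mixed strategies

Literature anchor for J. F. Nash, *Non-cooperative games*, Ann. of Math. 54 (1951) 286–295
[Nash1951] (Theorem 1: "every finite game has an equilibrium point"), in the presentation of
N. N. Vorob'ev, *Foundations of Game Theory — Noncooperative Games*, Birkhäuser 1994 [Vorobev1994],
Chapter 2, §1.1 (mixed extension of a finite noncooperative game, formulas (1.4)–(1.6)) and §1.6
("Existence theorem … known as Nash's theorem", Nash's own proof via Brouwer's fixed point theorem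
and the map (1.13)).

Setting. A finite game in normal form: a finite type of players `ι`, for each player `i` a finite
nonempty type of pure strategies `A i`, and payoff functions `u i : (Π j, A j) → ℝ`. A profile of
mixed strategies is `σ : Π i, (A i → ℝ)` with every `σ i` in the standard simplex
`stdSimplex ℝ (A i)`; the players randomise independently, so the expected payoff is the multilinear
extension `expectedPayoff (u i) σ = Σ_a (Π_j σ j (a j)) · u i a` (Vorob'ev (1.4)). A deviation of
player `i` to `τ` is `Function.update σ i τ`; `σ` is a **Nash equilibrium** if it is a mixed profile
and no player gains by a unilateral deviation to any mixed strategy.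

* `expectedPayoff_update` — linearity in a player's own strategy (Vorob'ev (1.5)–(1.6)):
  `U(σ ‖ τ) = Σ_b τ b · U(σ ‖ b)`.
* `exists_pos_and_le` — some pure strategy in the support of `σ i` does no better than `σ`
  against `σ` (Vorob'ev Ch. 1 Lemma 5.14 / Ch. 2 §1.2, the step used in §1.6).
* `isNashEquilibrium_of_nashMap_eq` — every fixed point of Nash's map
  `ψ(σ) i b = (σ i b + φᵢᵇ(σ)) / (1 + Σ_c φᵢᶜ(σ))`, `φᵢᵇ(σ) = max 0 (U(σ ‖ b) − U(σ))` (Vorob'ev (1.13))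
  is an equilibrium.
* `exists_isNashEquilibrium` — **Nash's theorem**: a fixed point exists by the Brouwer–Schauder
  theorem of the tree (`Literature.Analysis.Convex.exists_fixedPoint_of_mapsTo_isCompact`) applied to
  `ψ` on the compact convex product of simplices.
* `isNashEquilibrium_iff_pure_deviations` — it suffices to test pure deviations.

Related tree file: `Literature.Analysis.Convex.MinMax` (von Neumann's min-max theorem for finite
two-person zero-sum games, value form). Everything here is proved; the only definitions are the
transparent `expectedPayoff`, `IsMixedProfile`, `IsNashEquilibrium`, `gain`, `nashMap`; no `sorry`.
-/

open Finset Function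

noncomputable section

namespace Literature.Combinatorics.Games.NashEquilibrium

variable {ι : Type*} [Fintype ι] [DecidableEq ι] {A : ι → Type*} [∀ i, Fintype (A i)]
  [∀ i, DecidableEq (A i)]

/-! ## Mixed extension of a finite game -/

/-- Expected payoff of a payoff function `u : (Π j, A j) → ℝ` under the profile of mixed strategies
`σ` (independent randomisation): `Σ_a (Π_j σ j (a j)) · u a`. [cite: Vorobev1994, Ch. 2 §1.1 (1.4)] -/
def expectedPayoff (u : (∀ j, A j) → ℝ) (σ : ∀ j, A j → ℝ) : ℝ :=
  ∑ a : (∀ j, A j), (∏ j, σ j (a j)) * u a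

/-- `σ` is a profile of mixed strategies: each `σ i` is a probability vector on `A i`.
[cite: Vorobev1994, Ch. 2 §1.1 (1.2)–(1.3)] -/
def IsMixedProfile (σ : ∀ j, A j → ℝ) : Prop :=
  ∀ i, σ i ∈ stdSimplex ℝ (A i)

/-- **Nash equilibrium** (equilibrium point / equilibrium situation) of the finite game with payoffs
`u i` in mixed strategies: a mixed profile from which no player can profitably deviate to any mixed
strategy. [cite: Nash1951, §2 (Equilibrium Points)] -/
def IsNashEquilibrium (u : ι → (∀ j, A j) → ℝ) (σ : ∀ j, A j → ℝ) : Prop :=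
  IsMixedProfile σ ∧
    ∀ i, ∀ τ ∈ stdSimplex ℝ (A i), expectedPayoff (u i) (update σ i τ) ≤ expectedPayoff (u i) σ

omit [∀ i, DecidableEq (A i)] in
/-- The expected payoff is a continuous (polynomial) function of the profile. [folklore] -/
private theorem continuous_expectedPayoff (u : (∀ j, A j) → ℝ) :
    Continuous fun σ : ∀ j, A j → ℝ => expectedPayoff u σ := by
  unfold expectedPayoff
  refine continuous_finsetSum _ fun a _ => Continuous.mul ?_ continuous_const
  exact continuous_finsetProd _ fun j _ => (continuous_apply (a j)).comp (continuous_apply j)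

omit [∀ i, DecidableEq (A i)] in
/-- Expected payoff after player `i` deviates to `τ`, with the `i`-th factor pulled out:
`U(σ ‖ τ) = Σ_a τ (a i) · (Π_{j ≠ i} σ j (a j)) · u a`. [cite: Vorobev1994, Ch. 2 §1.1 (1.5)] -/
theorem expectedPayoff_update_eq (u : (∀ j, A j) → ℝ) (σ : ∀ j, A j → ℝ) (i : ι) (τ : A i → ℝ) :
    expectedPayoff u (update σ i τ) =
      ∑ a : (∀ j, A j), τ (a i) * ((∏ j ∈ univ.erase i, σ j (a j)) * u a) := by
  unfold expectedPayoff
  refine Finset.sum_congr rfl fun a _ => ?_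
  rw [← Finset.mul_prod_erase univ (fun j => (update σ i τ) j (a j)) (mem_univ i)]
  have h1 : (update σ i τ) i (a i) = τ (a i) := by rw [update_self]
  have h2 : ∏ j ∈ univ.erase i, (update σ i τ) j (a j) = ∏ j ∈ univ.erase i, σ j (a j) :=
    Finset.prod_congr rfl fun j hj => by rw [update_of_ne (ne_of_mem_erase hj)]
  rw [h1, h2, mul_assoc]

/-- **Linearity in a player's own mixed strategy**: the payoff after deviating to `τ` is the
`τ`-average of the payoffs after deviating to the pure strategies `b` (`Pi.single b 1`).
[cite: Vorobev1994, Ch. 2 §1.1 (1.6)] -/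
theorem expectedPayoff_update (u : (∀ j, A j) → ℝ) (σ : ∀ j, A j → ℝ) (i : ι) (τ : A i → ℝ) :
    expectedPayoff u (update σ i τ) =
      ∑ b : A i, τ b * expectedPayoff u (update σ i (Pi.single b 1)) := by
  simp_rw [expectedPayoff_update_eq, Pi.single_apply, ite_mul, one_mul, zero_mul, Finset.mul_sum]
  rw [Finset.sum_comm]
  refine Finset.sum_congr rfl fun a _ => ?_
  simp_rw [mul_ite, mul_zero]
  rw [Finset.sum_ite_eq, if_pos (mem_univ _)]

/-- The expected payoff of a mixed profile is the `σ i`-average of the payoffs of `i`'s pure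
strategies against `σ`. [cite: Vorobev1994, Ch. 2 §1.1 (1.6)] -/
theorem expectedPayoff_eq_sum_pure (u : (∀ j, A j) → ℝ) (σ : ∀ j, A j → ℝ) (i : ι) :
    expectedPayoff u σ = ∑ b : A i, σ i b * expectedPayoff u (update σ i (Pi.single b 1)) := by
  conv_lhs => rw [← update_eq_self i σ]
  exact expectedPayoff_update u σ i (σ i)

/-- **The support lemma** (Vorob'ev Ch. 2 §1.2 / the step "according to the lemma in Chapter 1,
5.14" of §1.6): if `σ i` is a probability vector, some pure strategy `b` with `σ i b > 0` earns at
most the current payoff against `σ`. [cite: Vorobev1994, Ch. 2 §1.2 (Lemma)] -/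
theorem exists_pos_and_le (u : (∀ j, A j) → ℝ) {σ : ∀ j, A j → ℝ} {i : ι}
    (hσ : σ i ∈ stdSimplex ℝ (A i)) :
    ∃ b : A i, 0 < σ i b ∧
      expectedPayoff u (update σ i (Pi.single b 1)) ≤ expectedPayoff u σ := by
  by_contra H
  push Not at H
  have hpos : ∃ b : A i, 0 < σ i b := by
    by_contra H'
    push Not at H'
    have h0 : ∑ b, σ i b ≤ 0 := Finset.sum_nonpos fun b _ => H' b
    linarith [hσ.2]
  obtain ⟨b₀, hb₀⟩ := hpos
  have hlt : ∑ b : A i, σ i b * expectedPayoff u σ <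
      ∑ b : A i, σ i b * expectedPayoff u (update σ i (Pi.single b 1)) := by
    refine Finset.sum_lt_sum (fun b _ => ?_) ⟨b₀, mem_univ _, ?_⟩
    · rcases (hσ.1 b).eq_or_lt with h | h
      · rw [← h, zero_mul, zero_mul]
      · exact (mul_le_mul_of_nonneg_left (H b h).le (hσ.1 b))
    · exact mul_lt_mul_of_pos_left (H b₀ hb₀) hb₀
  rw [← Finset.sum_mul, hσ.2, one_mul, ← expectedPayoff_eq_sum_pure] at hlt
  exact lt_irrefl _ hlt

/-! ## Nash's map -/

/-- Nash's gain functions `φᵢᵇ(σ) = max 0 (U_i(σ ‖ b) − U_i(σ))`. [cite: Vorobev1994, Ch. 2 §1.6] -/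
def gain (u : ι → (∀ j, A j) → ℝ) (σ : ∀ j, A j → ℝ) (i : ι) (b : A i) : ℝ :=
  max 0 (expectedPayoff (u i) (update σ i (Pi.single b 1)) - expectedPayoff (u i) σ)

/-- Nash's continuous improvement map `ψ(σ) i b = (σ i b + φᵢᵇ(σ)) / (1 + Σ_c φᵢᶜ(σ))`.
[cite: Vorobev1994, Ch. 2 §1.6 (1.13)] -/
def nashMap (u : ι → (∀ j, A j) → ℝ) (σ : ∀ j, A j → ℝ) : ∀ j, A j → ℝ :=
  fun i b => (σ i b + gain u σ i b) / (1 + ∑ c, gain u σ i c)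

/-- The regret/gain terms of Nash's map are nonnegative. [folklore] -/
private theorem gain_nonneg (u : ι → (∀ j, A j) → ℝ) (σ : ∀ j, A j → ℝ) (i : ι) (b : A i) :
    0 ≤ gain u σ i b :=
  le_max_left _ _

/-- The normalising denominator `1 + Σ_c gain` of Nash's map is positive. [folklore] -/
private theorem one_add_sum_gain_pos (u : ι → (∀ j, A j) → ℝ) (σ : ∀ j, A j → ℝ) (i : ι) :
    0 < 1 + ∑ c, gain u σ i c :=
  add_pos_of_pos_of_nonneg one_pos (Finset.sum_nonneg fun c _ => gain_nonneg u σ i c)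

/-- Nash's map is continuous. [cite: Vorobev1994, Ch. 2 §1.6] -/
theorem continuous_nashMap (u : ι → (∀ j, A j) → ℝ) :
    Continuous fun σ : ∀ j, A j → ℝ => nashMap u σ := by
  have hU : ∀ i, Continuous fun σ : ∀ j, A j → ℝ => expectedPayoff (u i) σ :=
    fun i => continuous_expectedPayoff (u i)
  have hUb : ∀ i (b : A i), Continuous fun σ : ∀ j, A j → ℝ =>
      expectedPayoff (u i) (update σ i (Pi.single b 1)) := by
    intro i b
    -- use the pulled-out formula, which is polynomial in `σ`
    have : (fun σ : ∀ j, A j → ℝ => expectedPayoff (u i) (update σ i (Pi.single b 1))) =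
        fun σ => ∑ a : (∀ j, A j), (Pi.single b (1 : ℝ) : A i → ℝ) (a i) *
          ((∏ j ∈ univ.erase i, σ j (a j)) * u i a) := by
      funext σ; exact expectedPayoff_update_eq (u i) σ i _
    rw [this]
    refine continuous_finsetSum _ fun a _ => continuous_const.mul (Continuous.mul ?_ continuous_const)
    exact continuous_finsetProd _ fun j _ => (continuous_apply (a j)).comp (continuous_apply j)
  have hg : ∀ i (b : A i), Continuous fun σ : ∀ j, A j → ℝ => gain u σ i b :=
    fun i b => continuous_const.max ((hUb i b).sub (hU i))
  refine continuous_pi fun i => continuous_pi fun b => ?_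
  exact (((continuous_apply b).comp (continuous_apply i)).add (hg i b)).div
    (continuous_const.add (continuous_finsetSum _ fun c _ => hg i c))
    fun σ => (one_add_sum_gain_pos u σ i).ne'

/-- Nash's map sends mixed profiles to mixed profiles. [cite: Vorobev1994, Ch. 2 §1.6] -/
theorem isMixedProfile_nashMap (u : ι → (∀ j, A j) → ℝ) {σ : ∀ j, A j → ℝ}
    (hσ : IsMixedProfile σ) : IsMixedProfile (nashMap u σ) := by
  intro i
  have hd := one_add_sum_gain_pos u σ i
  refine ⟨fun b => div_nonneg (add_nonneg ((hσ i).1 b) (gain_nonneg u σ i b)) hd.le, ?_⟩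
  simp only [nashMap]
  rw [← Finset.sum_div, Finset.sum_add_distrib, (hσ i).2, div_self hd.ne']

/-- **Fixed points of Nash's map are equilibria.** [cite: Vorobev1994, Ch. 2 §1.6] -/
theorem isNashEquilibrium_of_nashMap_eq (u : ι → (∀ j, A j) → ℝ) {σ : ∀ j, A j → ℝ}
    (hσ : IsMixedProfile σ) (hfix : nashMap u σ = σ) : IsNashEquilibrium u σ := by
  refine ⟨hσ, fun i => ?_⟩
  have hd := one_add_sum_gain_pos u σ i
  -- the fixed-point equation for player `i`: `σ i b · Σ_c φ = φ_b`
  have hfb : ∀ b : A i, σ i b * ∑ c, gain u σ i c = gain u σ i b := by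
    intro b
    have h := congrArg (fun τ : ∀ j, A j → ℝ => τ i b) hfix
    simp only [nashMap] at h
    rw [div_eq_iff hd.ne'] at h
    linarith
  -- a pure strategy in the support with zero gain forces all gains to vanish
  obtain ⟨b₀, hb₀, hle⟩ := exists_pos_and_le (u i) (hσ i)
  have hg0 : gain u σ i b₀ = 0 := max_eq_left (sub_nonpos.2 hle)
  have hsum : ∑ c, gain u σ i c = 0 := by
    have h := hfb b₀
    rw [hg0] at h
    rcases mul_eq_zero.1 h with h | h
    · exact absurd h hb₀.ne'
    · exact h
  have hall : ∀ c : A i, gain u σ i c = 0 := fun c =>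
    (Finset.sum_eq_zero_iff_of_nonneg fun c _ => gain_nonneg u σ i c).1 hsum c (mem_univ c)
  have hpure : ∀ c : A i,
      expectedPayoff (u i) (update σ i (Pi.single c 1)) ≤ expectedPayoff (u i) σ := by
    intro c
    have h := hall c
    unfold gain at h
    exact sub_nonpos.1 ((max_eq_left_iff).1 h)
  -- mixed deviations are averages of pure ones
  intro τ hτ
  rw [expectedPayoff_update]
  calc ∑ b, τ b * expectedPayoff (u i) (update σ i (Pi.single b 1))
      ≤ ∑ b, τ b * expectedPayoff (u i) σ :=
        Finset.sum_le_sum fun b _ => mul_le_mul_of_nonneg_left (hpure b) (hτ.1 b)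
    _ = expectedPayoff (u i) σ := by rw [← Finset.sum_mul, hτ.2, one_mul]

/-! ## Nash's theorem -/

/-- **Nash's theorem (1950/51).** Every finite game in normal form — finitely many players, each
with a finite nonempty set of pure strategies, arbitrary real payoffs — has an equilibrium point in
mixed strategies. Proof: Nash's map `ψ` is a continuous self-map of the nonempty compact convex set
of mixed profiles (a product of standard simplices in the finite-dimensional space
`Π i, (A i → ℝ)`), so it has a fixed point by the Brouwer–Schauder theorem, and fixed points are
equilibria. [cite: Nash1951, Thm 1] -/
theorem exists_isNashEquilibrium [∀ i, Nonempty (A i)] (u : ι → (∀ j, A j) → ℝ) :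
    ∃ σ : ∀ j, A j → ℝ, IsNashEquilibrium u σ := by
  classical
  set S : Set (∀ j, A j → ℝ) := Set.pi Set.univ fun i => stdSimplex ℝ (A i) with hS
  have hSc : IsCompact S := isCompact_univ_pi fun i => isCompact_stdSimplex ℝ (A i)
  have hSconv : Convex ℝ S := convex_pi fun i _ => convex_stdSimplex ℝ (A i)
  have hSne : S.Nonempty :=
    ⟨fun i => Pi.single (Classical.arbitrary (A i)) 1,
      fun i _ => single_mem_stdSimplex ℝ (Classical.arbitrary (A i))⟩
  have hmem : ∀ σ, σ ∈ S ↔ IsMixedProfile σ := fun σ => by simp [hS, IsMixedProfile, Set.mem_pi]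
  have hmaps : Set.MapsTo (nashMap u) S S := fun σ hσ =>
    (hmem _).2 (isMixedProfile_nashMap u ((hmem σ).1 hσ))
  obtain ⟨σ, hσS, hfix⟩ :=
    Literature.Analysis.Convex.exists_fixedPoint_of_mapsTo_isCompact hSconv hSc.isClosed hSne hSc
      (continuous_nashMap u).continuousOn hmaps hmaps
  exact ⟨σ, isNashEquilibrium_of_nashMap_eq u ((hmem σ).1 hσS) hfix⟩
#harness_tags exists_isNashEquilibrium

/-- It suffices to test **pure** deviations: a mixed profile is an equilibrium iff no player gains
by switching to a pure strategy. [cite: Vorobev1994, Ch. 2 §1.2] -/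
theorem isNashEquilibrium_iff_pure_deviations (u : ι → (∀ j, A j) → ℝ) (σ : ∀ j, A j → ℝ) :
    IsNashEquilibrium u σ ↔ IsMixedProfile σ ∧ ∀ i (b : A i),
      expectedPayoff (u i) (update σ i (Pi.single b 1)) ≤ expectedPayoff (u i) σ := by
  constructor
  · rintro ⟨hσ, h⟩
    exact ⟨hσ, fun i b => h i _ (single_mem_stdSimplex ℝ b)⟩
  · rintro ⟨hσ, h⟩
    refine ⟨hσ, fun i τ hτ => ?_⟩
    rw [expectedPayoff_update]
    calc ∑ b, τ b * expectedPayoff (u i) (update σ i (Pi.single b 1))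
        ≤ ∑ b, τ b * expectedPayoff (u i) σ :=
          Finset.sum_le_sum fun b _ => mul_le_mul_of_nonneg_left (h i b) (hτ.1 b)
      _ = expectedPayoff (u i) σ := by rw [← Finset.sum_mul, hτ.2, one_mul]
#harness_tags isNashEquilibrium_iff_pure_deviations

/-- **In an equilibrium every pure strategy in a player's support is a best reply** (earns exactly
the equilibrium payoff). [cite: Vorobev1994, Ch. 2 §1.2 (Lemma, (1.7)–(1.8))] -/
theorem expectedPayoff_pure_eq_of_pos {u : ι → (∀ j, A j) → ℝ} {σ : ∀ j, A j → ℝ}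
    (hσ : IsNashEquilibrium u σ) {i : ι} {b : A i} (hb : 0 < σ i b) :
    expectedPayoff (u i) (update σ i (Pi.single b 1)) = expectedPayoff (u i) σ := by
  have hpure := ((isNashEquilibrium_iff_pure_deviations u σ).1 hσ).2 i
  refine le_antisymm (hpure b) ?_
  by_contra H
  push Not at H
  have hsimp := hσ.1 i
  have hlt : ∑ c : A i, σ i c * expectedPayoff (u i) (update σ i (Pi.single c 1)) <
      ∑ c : A i, σ i c * expectedPayoff (u i) σ := by
    refine Finset.sum_lt_sum (fun c _ => mul_le_mul_of_nonneg_left (hpure c) (hsimp.1 c))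
      ⟨b, mem_univ _, mul_lt_mul_of_pos_left H hb⟩
  rw [← Finset.sum_mul, hsimp.2, one_mul, ← expectedPayoff_eq_sum_pure] at hlt
  exact lt_irrefl _ hlt
#harness_tags expectedPayoff_pure_eq_of_pos

end Literature.Combinatorics.Games.NashEquilibrium

end
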